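import Mathlib.Analysis.Calculus.Deriv.Slope
import Mathlib.Topology.Order.Compact
import Summits.Ventures.CertifiedManyBodySolver.Downfold.CoexistencePressureBracketRows
import HarnessLib

/-!
# The static coexistence pressure of two phases from finitely many relaxations, III:
# the envelope theorem `dH/dP = V(P)` and the volumes-only contrast-band bracket

Venture CertifiedManyBodySolver, cell `pub/hubbard-downfold` (S1 = ROUTER), seat hubbard-downfold-tool-2;
namespace `Summit.Ventures.CertifiedManyBodySolver.Downfold.StructFlag`. Companion of
`CoexistencePressureBracket` (I: minimum principle, sandwich, two-point bracket) and
`CoexistencePressureBracketRows` (II: uniqueness/existence, the contrast-band bracket stated with a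
DERIVATIVE band `-c_hi ≤ ΔH' ≤ -c_lo`, rows of record). Part II's band hypothesis is about `ΔH'`; what
a relaxation prints is a VOLUME. This file closes that gap:

* §5 THE ENVELOPE THEOREM at `T = 0`: the slope of the minimal enthalpy between two pressures lies
  between the two relaxed volumes (`slope_minEnthalpy_mem_Icc`, from Part I's sandwich), hence
  wherever the relaxed volume `v` is continuous the minimal enthalpy is differentiable with
  `dH/dP = v(P)` (`hasDerivAt_minEnthalpy`) — the `T = 0` statement of `Ω = ∂G/∂P|_T`
  [cite: Kaxiras2003, App. C Table C.1] — and `d(ΔH)/dP = v₂(P) - v₁(P)` (`hasDerivAt_deltaH`).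
* §5b EXISTENCE AT MODEL LEVEL: relaxed volumes exist for a continuous `E(V)` on a compact volume
  range (`exists_isMinOn_enthalpy`), hence two continuous energy–volume curves ordered oppositely
  in minimal enthalpy at `P_a ≤ P_b` have a coexistence pressure in `[P_a, P_b]`
  (`exists_coexistence_of_continuousOn`) — the existence half of the Maxwell construction
  [cite: Kaxiras2003, §5.6.1 (discussion of Fig. 5.6)] with no convexity or tangency assumed.
* §6 THE VOLUMES-ONLY CONTRAST-BAND BRACKET (`coexistence_mem_Icc_of_contrast_band`): if both phases
  are relaxed at every pressure of `[P_a, P_b]` with relaxed-volume functions continuous on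
  `(P_a, P_b)` and the SAME-PRESSURE contrast `v₁(P) - v₂(P)` stays in a declared band
  `[c_lo, c_hi]`, `0 < c_lo`, then a coexistence pressure `P*` with `ΔH(P_a) = h_a`,
  `ΔH(P_b) = -h_b` obeys `max (P_a + h_a/c_hi) (P_b - h_b/c_lo) ≤ P* ≤ min (P_a + h_a/c_lo) (P_b - h_b/c_hi)`
  — Part II's `coexistence_mem_Icc_of_deriv_band` with the derivative band DISCHARGED by §5.
* §7 ROW: LaH₁₀ (200, 250) GPa restated on volumes (`lah10_coexistence_window_of_contrast_band`):
  under the band `V_C2/m(P) - V_Fm-3m(P) ∈ [0.035, 0.092] Å³/f.u.` (hull of the two computed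
  contrasts) and continuity of the two relaxed-volume curves, `228.4 ≤ P* ≤ 241.9 GPa`.

Everything is PROVED. WHAT THIS IS NOT: a claim about LaH₁₀ — the band is a SCREENING hypothesis
(two computed contrasts do not bound the contrast in between); continuity of the relaxed volume is
an assumption about the static PES branch followed by the relaxations (it fails across a first-order
jump of the SAME phase, which is exactly when a new basin should be declared).
-/

open Set Filter Topology

namespace Summit.Ventures.CertifiedManyBodySolver.Downfold.StructFlag

open Literature.MathematicalPhysics.StatisticalMechanics (enthalpy)

/-! ## §5 The envelope theorem `dH/dP = V(P)` -/

/-- **Slope sandwich.** Between two distinct pressures the secant slope of the minimal enthalpy lies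
between the two relaxed volumes: `(H(q) - H(p))/(q - p) ∈ [min V_p V_q, max V_p V_q]`. [folklore] -/
theorem slope_minEnthalpy_mem_Icc {E : ℝ → ℝ} {S : Set ℝ} {p q Vp Vq : ℝ}
    (hp : IsMinOn (enthalpy E p) S Vp) (hq : IsMinOn (enthalpy E q) S Vq)
    (hVp : Vp ∈ S) (hVq : Vq ∈ S) (hpq : p ≠ q) :
    (enthalpy E q Vq - enthalpy E p Vp) / (q - p) ∈ Icc (min Vp Vq) (max Vp Vq) := by
  obtain ⟨lo, hi⟩ := minEnthalpy_sub_mem_Icc hp hq hVp hVq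
  rcases lt_or_gt_of_ne hpq with hlt | hgt
  · have hd : 0 < q - p := sub_pos.mpr hlt
    refine ⟨le_trans (min_le_right _ _) ?_, le_trans ?_ (le_max_left _ _)⟩
    · rw [le_div_iff₀ hd]; linarith
    · rw [div_le_iff₀ hd]; linarith
  · have hd : q - p < 0 := sub_neg.mpr hgt
    refine ⟨le_trans (min_le_left _ _) ?_, le_trans ?_ (le_max_right _ _)⟩
    · rw [le_div_iff_of_neg hd]; linarith
    · rw [div_le_iff_of_neg hd]; linarith

/-- **ENVELOPE THEOREM (`T = 0` form of `Ω = ∂G/∂P` at fixed `T`).** If a phase is relaxed at every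
pressure of a neighbourhood `D` of `p` and the relaxed volume `v` is continuous at `p`, the minimal
enthalpy `P ↦ H(P)` is differentiable at `p` with derivative `v(p)` — no convexity or smoothness of
`E(V)` is used. [folklore] -/
theorem hasDerivAt_minEnthalpy {E : ℝ → ℝ} {S D : Set ℝ} {v : ℝ → ℝ} {p : ℝ} (hD : D ∈ 𝓝 p)
    (hS : ∀ P ∈ D, v P ∈ S) (hmin : ∀ P ∈ D, IsMinOn (enthalpy E P) S (v P))
    (hv : ContinuousAt v p) : HasDerivAt (fun P => enthalpy E P (v P)) (v p) p := by
  have hpD : p ∈ D := mem_of_mem_nhds hD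
  rw [hasDerivAt_iff_tendsto_slope]
  have hvc : Tendsto v (𝓝[≠] p) (𝓝 (v p)) := hv.tendsto.mono_left nhdsWithin_le_nhds
  have hconst : Tendsto (fun _ : ℝ => v p) (𝓝[≠] p) (𝓝 (v p)) := tendsto_const_nhds
  have hlo : Tendsto (fun q => min (v p) (v q)) (𝓝[≠] p) (𝓝 (v p)) := by
    simpa only [min_self] using hconst.min hvc
  have hhi : Tendsto (fun q => max (v p) (v q)) (𝓝[≠] p) (𝓝 (v p)) := by
    simpa only [max_self] using hconst.max hvc
  have hev : ∀ᶠ q in 𝓝[≠] p, q ∈ D ∧ q ≠ p := by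
    filter_upwards [mem_nhdsWithin_of_mem_nhds hD, self_mem_nhdsWithin] with q hq hq'
    exact ⟨hq, Set.mem_compl_singleton_iff.mp hq'⟩
  refine tendsto_of_tendsto_of_tendsto_of_le_of_le' hlo hhi ?_ ?_
  · filter_upwards [hev] with q hq
    rw [slope_def_field]
    exact (slope_minEnthalpy_mem_Icc (hmin p hpD) (hmin q hq.1) (hS p hpD) (hS q hq.1) hq.2.symm).1
  · filter_upwards [hev] with q hq
    rw [slope_def_field]
    exact (slope_minEnthalpy_mem_Icc (hmin p hpD) (hmin q hq.1) (hS p hpD) (hS q hq.1) hq.2.symm).2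

/-- **Derivative of the enthalpy difference of two phases** where both relaxed volumes are
continuous: `d(ΔH)/dP = v₂(p) - v₁(p)` (minus the same-pressure volume contrast). [folklore] -/
theorem hasDerivAt_deltaH {E₁ E₂ : ℝ → ℝ} {S₁ S₂ D : Set ℝ} {v₁ v₂ : ℝ → ℝ} {p : ℝ} (hD : D ∈ 𝓝 p)
    (hS₁ : ∀ P ∈ D, v₁ P ∈ S₁) (hmin₁ : ∀ P ∈ D, IsMinOn (enthalpy E₁ P) S₁ (v₁ P))
    (hS₂ : ∀ P ∈ D, v₂ P ∈ S₂) (hmin₂ : ∀ P ∈ D, IsMinOn (enthalpy E₂ P) S₂ (v₂ P))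
    (hv₁ : ContinuousAt v₁ p) (hv₂ : ContinuousAt v₂ p) :
    HasDerivAt (fun P => enthalpy E₂ P (v₂ P) - enthalpy E₁ P (v₁ P)) (v₂ p - v₁ p) p :=
  (hasDerivAt_minEnthalpy hD hS₂ hmin₂ hv₂).sub (hasDerivAt_minEnthalpy hD hS₁ hmin₁ hv₁)

/-! ## §5b Existence of the coexistence pressure for two continuous energy–volume curves -/

/-- **Relaxed volumes exist** for a continuous energy–volume curve on a compact non-empty volume
range: at every pressure some admissible volume minimises the enthalpy. [folklore] -/
theorem exists_isMinOn_enthalpy {E : ℝ → ℝ} {S : Set ℝ} (hSc : IsCompact S) (hSn : S.Nonempty)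
    (hE : ContinuousOn E S) (P : ℝ) : ∃ V ∈ S, IsMinOn (enthalpy E P) S V := by
  have hc : ContinuousOn (enthalpy E P) S := by
    show ContinuousOn (fun V => E V + P * V) S
    exact hE.add (continuous_const.mul continuous_id).continuousOn
  exact hSc.exists_isMinOn hSn hc

/-- **EXISTENCE OF THE MAXWELL PRESSURE, model level.** Two phases with CONTINUOUS energy–volume
curves `E₁`, `E₂` on compact non-empty volume ranges `S₁`, `S₂`; if phase 1 is not higher in
minimal enthalpy at `P_a` and phase 2 is not higher at `P_b ≥ P_a`, there is a pressure
`P* ∈ [P_a, P_b]` and relaxed volumes `u ∈ S₁`, `w ∈ S₂` at `P*` with equal enthalpies — no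
convexity, no common tangent assumed (the tangent construction of
`Literature…commonTangent_transitionPressure` is the smooth convex special case). [folklore] -/
theorem exists_coexistence_of_continuousOn {E₁ E₂ : ℝ → ℝ} {S₁ S₂ : Set ℝ} {P_a P_b : ℝ}
    (hab : P_a ≤ P_b) (hS₁c : IsCompact S₁) (hS₁n : S₁.Nonempty) (hE₁ : ContinuousOn E₁ S₁)
    (hS₂c : IsCompact S₂) (hS₂n : S₂.Nonempty) (hE₂ : ContinuousOn E₂ S₂)
    (ha : ∃ u ∈ S₁, ∀ w ∈ S₂, enthalpy E₁ P_a u ≤ enthalpy E₂ P_a w)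
    (hb : ∃ w ∈ S₂, ∀ u ∈ S₁, enthalpy E₂ P_b w ≤ enthalpy E₁ P_b u) :
    ∃ P ∈ Icc P_a P_b, ∃ u ∈ S₁, ∃ w ∈ S₂,
      IsMinOn (enthalpy E₁ P) S₁ u ∧ IsMinOn (enthalpy E₂ P) S₂ w ∧
        enthalpy E₂ P w = enthalpy E₁ P u := by
  classical
  choose v₁ hv₁S hv₁min using fun P => exists_isMinOn_enthalpy hS₁c hS₁n hE₁ P
  choose v₂ hv₂S hv₂min using fun P => exists_isMinOn_enthalpy hS₂c hS₂n hE₂ P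
  obtain ⟨u₀, hu₀, hu₀le⟩ := ha
  obtain ⟨w₀, hw₀, hw₀le⟩ := hb
  have ha' : enthalpy E₁ P_a (v₁ P_a) ≤ enthalpy E₂ P_a (v₂ P_a) :=
    ((isMinOn_iff.mp (hv₁min P_a)) u₀ hu₀).trans (hu₀le _ (hv₂S P_a))
  have hb' : enthalpy E₂ P_b (v₂ P_b) ≤ enthalpy E₁ P_b (v₁ P_b) :=
    ((isMinOn_iff.mp (hv₂min P_b)) w₀ hw₀).trans (hw₀le _ (hv₁S P_b))
  obtain ⟨P, hP, hPeq⟩ := exists_coexistence hab (fun P _ => hv₁S P) (fun P _ => hv₁min P)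
    (fun P _ => hv₂S P) (fun P _ => hv₂min P) ha' hb'
  exact ⟨P, hP, v₁ P, hv₁S P, v₂ P, hv₂S P, hv₁min P, hv₂min P, hPeq⟩

/-! ## §6 The volumes-only contrast-band bracket -/

/-- **Coexistence bracket under a band for the SAME-PRESSURE volume contrast (volumes only).** Both
phases relaxed on `[P_a, P_b]`, relaxed-volume functions continuous on `(P_a, P_b)`, contrast
`v₁(P) - v₂(P) ∈ [c_lo, c_hi]` there with `0 < c_lo ≤ c_hi`; `ΔH(P_a) = h_a`, `ΔH(P_b) = -h_b`,
`ΔH(P*) = 0`, `P_a ≤ P* ≤ P_b`. Then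
`max (P_a + h_a/c_hi) (P_b - h_b/c_lo) ≤ P* ≤ min (P_a + h_a/c_lo) (P_b - h_b/c_hi)`. [folklore] -/
theorem coexistence_mem_Icc_of_contrast_band {E₁ E₂ : ℝ → ℝ} {S₁ S₂ : Set ℝ} {v₁ v₂ : ℝ → ℝ}
    {P_a P_s P_b h_a h_b c_lo c_hi : ℝ}
    (hS₁ : ∀ P ∈ Icc P_a P_b, v₁ P ∈ S₁) (hmin₁ : ∀ P ∈ Icc P_a P_b, IsMinOn (enthalpy E₁ P) S₁ (v₁ P))
    (hS₂ : ∀ P ∈ Icc P_a P_b, v₂ P ∈ S₂) (hmin₂ : ∀ P ∈ Icc P_a P_b, IsMinOn (enthalpy E₂ P) S₂ (v₂ P))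
    (hc₁ : ContinuousOn v₁ (Ioo P_a P_b)) (hc₂ : ContinuousOn v₂ (Ioo P_a P_b))
    (hband : ∀ P ∈ Ioo P_a P_b, v₁ P - v₂ P ∈ Icc c_lo c_hi) (hc : 0 < c_lo) (hcc : c_lo ≤ c_hi)
    (has : P_a ≤ P_s) (hsb : P_s ≤ P_b)
    (hfa : enthalpy E₂ P_a (v₂ P_a) - enthalpy E₁ P_a (v₁ P_a) = h_a)
    (hfs : enthalpy E₂ P_s (v₂ P_s) - enthalpy E₁ P_s (v₁ P_s) = 0)
    (hfb : enthalpy E₂ P_b (v₂ P_b) - enthalpy E₁ P_b (v₁ P_b) = -h_b) :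
    P_s ∈ Icc (max (P_a + h_a / c_hi) (P_b - h_b / c_lo))
      (min (P_a + h_a / c_lo) (P_b - h_b / c_hi)) := by
  have hcont : ContinuousOn (fun P => enthalpy E₂ P (v₂ P) - enthalpy E₁ P (v₁ P)) (Icc P_a P_b) :=
    (continuousOn_minEnthalpy hS₂ hmin₂).sub (continuousOn_minEnthalpy hS₁ hmin₁)
  have hder : ∀ x ∈ Ioo P_a P_b,
      HasDerivAt (fun P => enthalpy E₂ P (v₂ P) - enthalpy E₁ P (v₁ P)) (v₂ x - v₁ x) x := by
    intro x hx
    have hxD : Ioo P_a P_b ∈ 𝓝 x := isOpen_Ioo.mem_nhds hx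
    exact hasDerivAt_deltaH hxD (fun P hP => hS₁ P (Ioo_subset_Icc_self hP))
      (fun P hP => hmin₁ P (Ioo_subset_Icc_self hP)) (fun P hP => hS₂ P (Ioo_subset_Icc_self hP))
      (fun P hP => hmin₂ P (Ioo_subset_Icc_self hP)) (hc₁.continuousAt hxD) (hc₂.continuousAt hxD)
  have hband' : ∀ x ∈ Ioo P_a P_b, v₂ x - v₁ x ∈ Icc (-c_hi) (-c_lo) := by
    intro x hx
    obtain ⟨l, u⟩ := hband x hx
    exact ⟨by linarith, by linarith⟩
  exact coexistence_mem_Icc_of_deriv_band (f' := fun x => v₂ x - v₁ x) hcont hder hband' hc hcc has hsb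
    hfa hfs hfb

/-! ## §7 Row of record on volumes -/

/-- **LaH₁₀ (200, 250) GPa, static PBE, C2/m (phase 1) vs Fm-3m (phase 2), VOLUMES-ONLY band
form.** Hypotheses: both structures relaxed at every pressure between the computed points
(pressures in meV/Å³: `P·κ`, `κ = 5·10⁹/801088317`), relaxed volumes continuous in between, the
same-pressure contrast `V_C2/m - V_Fm-3m ∈ [0.035, 0.092] Å³/f.u.` (the hull of its two computed
values 30.642 - 30.550 and 28.593 - 28.558; a SCREENING hypothesis), `ΔH(200) = 14.0`,
`ΔH(250) = -4.7 meV/f.u.` (STRUCT-COMPARATOR-hydrides.md v1.3 §2.5). Conclusion: `228.4 ≤ P* ≤ 241.9 GPa`.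
WHAT THIS IS NOT: a statement about LaH₁₀'s phase diagram. [folklore] -/
theorem lah10_coexistence_window_of_contrast_band {E₁ E₂ : ℝ → ℝ} {S₁ S₂ : Set ℝ}
    {v₁ v₂ : ℝ → ℝ} {κ P_s : ℝ} (hκ : κ = 5000000000 / 801088317)
    (hS₁ : ∀ P ∈ Icc (200 * κ) (250 * κ), v₁ P ∈ S₁)
    (hmin₁ : ∀ P ∈ Icc (200 * κ) (250 * κ), IsMinOn (enthalpy E₁ P) S₁ (v₁ P))
    (hS₂ : ∀ P ∈ Icc (200 * κ) (250 * κ), v₂ P ∈ S₂)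
    (hmin₂ : ∀ P ∈ Icc (200 * κ) (250 * κ), IsMinOn (enthalpy E₂ P) S₂ (v₂ P))
    (hc₁ : ContinuousOn v₁ (Ioo (200 * κ) (250 * κ))) (hc₂ : ContinuousOn v₂ (Ioo (200 * κ) (250 * κ)))
    (hband : ∀ P ∈ Ioo (200 * κ) (250 * κ), v₁ P - v₂ P ∈ Icc (0.035 : ℝ) 0.092)
    (has : 200 ≤ P_s) (hsb : P_s ≤ 250)
    (hfa : enthalpy E₂ (200 * κ) (v₂ (200 * κ)) - enthalpy E₁ (200 * κ) (v₁ (200 * κ)) = 14.0)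
    (hfs : enthalpy E₂ (P_s * κ) (v₂ (P_s * κ)) - enthalpy E₁ (P_s * κ) (v₁ (P_s * κ)) = 0)
    (hfb : enthalpy E₂ (250 * κ) (v₂ (250 * κ)) - enthalpy E₁ (250 * κ) (v₁ (250 * κ)) = -4.7) :
    P_s ∈ Icc (228.4 : ℝ) 241.9 := by
  have hκpos : 0 < κ := by rw [hκ]; norm_num
  have has' : 200 * κ ≤ P_s * κ := mul_le_mul_of_nonneg_right has hκpos.le
  have hsb' : P_s * κ ≤ 250 * κ := mul_le_mul_of_nonneg_right hsb hκpos.le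
  obtain ⟨lo, hi⟩ := coexistence_mem_Icc_of_contrast_band hS₁ hmin₁ hS₂ hmin₂ hc₁ hc₂ hband
    (by norm_num) (by norm_num) has' hsb' hfa hfs (h_b := 4.7) hfb
  have lo' := (le_max_right _ _).trans lo
  have hi' := hi.trans (min_le_right _ _)
  rw [hκ] at lo' hi'
  norm_num at lo' hi'
  exact ⟨by linarith, by linarith⟩

end Summit.Ventures.CertifiedManyBodySolver.Downfold.StructFlag
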